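import Summits.QuantumFields.YangMills.Theorems.BalabanUVNodesN21AtKeyedRateHomeConst
import Summits.QuantumFields.YangMills.Theorems.BalabanUVNodesN21AtSRec13SepWeightHomes
import Summits.QuantumFields.YangMills.Theorems.BalabanUVNodesN16AtRRec13Sep

/-!
⁗ (SEPARATION-GUARD) EDITION of this seat's module 24 (‴ draft typed by g6 06:0xZ, farm rc 0, dry-run ACCEPT, NOT FILED after WORDS-140 — this ⁗ edition is the first filing) — dag-lead WORDS-140 (cell bus l.16872): the ‴ item (K3‴ `SpineGivenEndpointR13`, stmt-QuantumFields-19912) is an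
ASIDE after route rev 18∕19; the lane of record is K3⁗ `SpineGivenEndpointR13Sep` (stmt-QuantumFields-20292; `--kind proof --supports stmt-QuantumFields-20292 --as helper`).
STATEMENTS = the ‴ statements under node00-def-T's `Record13.lean` v1.2 token map (`Provisos₁₃ ↦ Provisos₁₃Sep`, `datumOfRecord₁₃ ↦ datumOfRecord₁₃Sep`,
`IsRecordOfRecord₁₃C ↦ IsRecordOfRecord₁₃CSep`), node00-def-RR-2's key names (`IsDatumOfRecord₁₃C(On) ↦ IsDatumOfRecord₁₃CSep(On)`, `Node00.Record13DatumKeySep`), dag-n22-e's (T-RATE) names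
(`RateReading₁₃ ∕ rateCarriersOfRecord₁₃ ∕ RRec₁₃(On) ∕ readingOfRecord₁₃ ↦ …₁₃Sep…`) and the spine-home names of dag-n27-c's twins of dag-n20-d's modules (`SpineReading₁₃ ∕ SRec₁₃(On)
∕ sRec₁₃ ∕ keyed₁₃ ∕ homes₁₃ ∕ rec13C ↦ …Sep…`); PROOFS VERBATIM under the map; θ-only declarations (`Stage13Params`, `Admissible`, `ZtUnity`, `SlotsNondegenerate₁₃`, `unityNondeg₁₃`,
RR-1's `ne3ConstLayerOfRecord₁₁`, THE END's letters) are NOT renamed.  Generated by this seat's `sep/gen.py` (suffix-parametric: the same pass serves a later `Sep ↦ …` re-key).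

# YM-DAG node N21 (= NE7c) AT THE STAGE-13 RATE-RECORD HOMES FOR A CONSTANT NE3 LAYER — the in-edge N16 BY NAME as the K4 stub `S_N16 (RRec₁₃Sep 𝔯)` ∕ `S_N16 (RRec₁₃SepOn 𝔯 Rg)`
# of a reading whose NE3 component is ONE object `o F` per family (dag-n16-e module 19 `n16At_of_s_N16_rRec₁₃Sep_constLayer` ∕ `…rRec₁₃SepOn_constLayer`), at node00-def-RR-1's
# PINNED OBJECT OF RECORD `Node00.ne3ConstLayerOfRecord₁₁ F N ℓ`, and THE N21 SLOT OF THE COMPOSITE KNIT AT THE STAGE-13 HOMES DISCHARGED DOWN TO ITS DISPLAYED BINDERS — the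
# ₁₃ twin of module 10 (`BalabanUVNodesN21AtRRec12ConstLayer`, p469867), on dag-n16-e's Stage-13 faces (g5 module 19 p494392)

Track A of `YM-PLAN.md` (cell `pub-ymgap`, HUMAN RULING D-0062), node **N21**; R134 fan-out seat `pub-ymgap-dag-n21-d` (s2 = BY-NAME KNIT at the record), generation 6,
module 24.  THEOREMS ONLY: 0 `def`, 0 `sorry`, standard axioms; COUNT-NEUTRAL; `--supports` the K3⁗ item `SpineGivenEndpointR13Sep` (stmt-QuantumFields-20292) as a helper.
`N`-generic, NO Theses import (restate-immune).  Imports module 8 `BalabanUVNodesN21AtKeyedRateHomeConst` (p465939: `shellWeightBound_geometric_of_constLayer_inEndRegime` ∕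
`…_u2Output`, stage-free), module 21c `BalabanUVNodesN21AtSRec13SepWeightHomes` (p496248: `spine_rec13CSep_of_homes₁₃Sep_existsShellWeight`; brings dag-n20-d's `SRec₁₃Sep`, dag-n22-e's
`RRec₁₃Sep`, dag-n27-c XXXVIII) and dag-n16-e's `BalabanUVNodesN16AtRRec13Sep` (p494392: `n16At_of_s_N16_rRec₁₃Sep_constLayer`, `n16At_of_s_N16_rRec₁₃SepOn_constLayer`; brings RR-2's
`Node00.Record13DatumKey` and RR-1's `Node00.RateRecord11NE3Data`).  Restates nothing; cites by name.

WHAT IS PROVED ([folklore] ∕ [bookkeeping]; each step ONE application BY NAME; 12 ↦ 13 of module 10 plus the regime-restricted home, which is new at Stage 13).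
* §0 `nu_A0_pos_of_isDatumOfRecord₁₃CSep` (`0 < h.params.ν.A₀` off RR-2's Stage-13 key).
* §1 CANONICAL HOME — `shellWeightBound_geometric_of_rRec₁₃Sep_constLayer_inEndRegime` ∕ `…_u2Output`: for a Stage-13 rate reading `𝔯` with constant NE3 component `o F`
  (`hconst`), the K4 stub `S_N16 (RRec₁₃Sep 𝔯)` and a datum key `h : IsDatumOfRecord₁₃CSep F N D` deliver N16's record decl at `ne3OfRecord₁₁ F (o F)` — hence, with THE END's proviso
  `InEndRegime` at the layer, the regularity numeral, `0 < Λ₂′`, explicit carriers with level ledgers ∕ live windows ∕ `D ≤ D̄`, threshold widths (geometric, or BY NAME from node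
  U2 `U2Output D g₀ Cout θ₂` tuned in the record's own window `D.Tuned h.params.γ g g₀`) and the two [dict] clauses: `∃ ϑ C, 0 < ϑ < 1 ∧ 0 ≤ C ∧ ShellWeightBound l₀ T A B shA shB (K ↦ C·ϑ^K)`.
  REGIME-RESTRICTED HOME — `shellWeightBound_geometric_of_rRec₁₃SepOn_constLayer_inEndRegime`: the same from `S_N16 (RRec₁₃SepOn 𝔯 Rg)` at a guarded admissible tuple `(θ, hP, hRg, hθ)`
  (the K3‴ item's own guard is `Rg := fun F θ => θ.ZtUnity F N ∧ θ.SlotsNondegenerate₁₃ F N`).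
* §2 AT THE PINNED OBJECT OF RECORD `o F := Node00.ne3ConstLayerOfRecord₁₁ F N (ℓ F)`: `…_rRec₁₃Sep_ofRecord_inEndRegime` ∕ `…_ofRecord_u2Output` (numerals at letter level; `hconst` is
  `fun … ↦ rfl` for RR-1's constant reading and for dag-n22-e's reading of record `readingOfRecord₁₃Sep w1 ℓ ne2 ne1` — its `readingOfRecord₁₃Sep_ne3`).
* §3 THE K5 FACES — `exists_shellWeight_keyed₁₃Sep_of_constLayer` (canonical stub, datum key `isDatumOfRecord₁₃CSep_datumOfRecord₁₃Sep`) and `exists_shellWeight_keyedOn₁₃Sep_of_constLayer`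
  (regime stub, at guarded tuples): «∀ admissible θ with provisos (and `Rg F θ`), ∀ g₀ os, ∃ Wsh, ShellWeightBound (cr F θ hP g₀ os) … Wsh» from NODE O's term-object readings `hread`.
* §4 THE COMPOSITE — `spine_rec13CSep_of_homes₁₃Sep_constLayer`: dag-n27-c XXXVIII's knit at the Stage-13 homes (via module 21c's ∃-weight form) with THE N21 SLOT DISCHARGED by §3: the
  in-edge N16 is the composite's own `h16`; what N21 adds to the hypothesis list is `hconst`, the proviso, the numerals and the term-object readings `hread`.  Conclusion `Spine ₁₃C`.

HONEST FRAMING (binding).  `S_N16 (RRec₁₃Sep 𝔯)` ∕ `S_N16 (RRec₁₃SepOn 𝔯 Rg)`, `InEndRegime`, `U2Output`, every K4 ∕ K5 stub, the N19′ edge, the ledgers ((M1) NOT PRINTED + [dict], incl.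
the (0.4)∕(42) averaging transfer — GAP-STATED of record), live windows, `D̄`, threshold widths and the [dict] ∕ [dict-thr] clauses are HYPOTHESES, displayed; the constant layer is
RR-1's pin CONVENTION with parametric letters; `cr`, `𝔯` are PARAMETERS (no reading of Bałaban's dressed two-run expansion exists in the tree); no inhabitant of `IsDatumOfRecord₁₃CSep`
claimed (K0‴ open); nothing of Bałaban's asserted; NE7 ∕ NE7b ∕ NE7c NOT PRINTED for d = 4 and NOT PROVED; **N21 NOT discharged**, N27 NOT discharged, K3‴ NOT claimed; typed 28∕28,
discharged count untouched; one finite four-torus programme at fixed `ε` — NOT ℝ⁴, NOT infinite volume, NOT OS, NOT a mass gap, NOT Clay.  No decl below carries a cite tag.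
-/

set_option autoImplicit false

noncomputable section

open scoped BigOperators Matrix Matrix.Norms.L2Operator

namespace Summit.QuantumFields.YangMills.Theorems.N21AtRRec13SepConstLayer

open Literature.MathematicalPhysics.QuantumFieldTheory.Balaban1983to89
open Literature.MathematicalPhysics.QuantumFieldTheory.Balaban1983to89.T4Continuum (T4Family ULoop FiniteEpsData)
open B7Prop1Explicit B7Prop2Explicit
open T4AveragingDeficitWall (Plane)
open T4WeightBudget (RelWeightBound)
open T4IndicatorShell (ShellWeightBound)
open T4ShellMeasureLevels (LevelLedger LiveWindow)
open Summit.QuantumFields.BalabanUV.T4Continuum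
open Summit.QuantumFields.BalabanUV.T4Continuum.Spine
open Summit.QuantumFields.BalabanUV.T4Continuum.Spine.NE4 (U2Output runFlow box_and_pin_of_tuned)
open MinimalActionSandwich (IsMinimiser)
open MinimalActionRate (Regular sfClass)
open MinimalActionRefine (RegularSup)
open AveragingDeficitDualResidual (dualC1 dualC2)
open AveragingDeficitDerivWallProof (wallConst)
open YMDAG.UVSplit
open Summit.QuantumFields.YangMills.BalabanUVNodes.N16Regime (InEndRegime)
open Summit.QuantumFields.YangMills.BalabanUVNodes.N16AtRRec13Sep (n16At_of_s_N16_rRec₁₃Sep_constLayer n16At_of_s_N16_rRec₁₃SepOn_constLayer)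
open N21AtKeyedRateHomeConst (shellWeightBound_geometric_of_constLayer_inEndRegime shellWeightBound_geometric_of_constLayer_u2Output)
open N21AtSRec13SepWeightHomes (spine_rec13CSep_of_homes₁₃Sep_existsShellWeight)
open Node00 (NE3Objects₁₁ NE3Letters₁₁ Stage13Params IsDatumOfRecord₁₃CSep IsRecordOfRecord₁₃CSep datumOfRecord₁₃Sep isDatumOfRecord₁₃CSep_datumOfRecord₁₃Sep epsOfRecord
  ne3ConstLayerOfRecord₁₁)

variable {N : ℕ} [NeZero N]

/-- **`0 < ν.A₀` AT THE STAGE-13 RECORD**: the numerics of the datum's canonical Stage-13 parameter have a positive small-field constant `A₀` — Stage-13 admissibility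
(RR-2's `IsDatumOfRecord₁₃CSep.admissible`) down to Stage 7's sign clause (module 7's Stage-12 face, 12 ↦ 13). [folklore] -/
theorem nu_A0_pos_of_isDatumOfRecord₁₃CSep {F : T4Family} {D : Datum F N} (h : IsDatumOfRecord₁₃CSep F N D) : 0 < h.params.ν.A₀ :=
  h.admissible.toStage9.toStage8.1.2.2.2.1

/-! ## §1 The constant NE3 layer at the Stage-13 home: N16 BY NAME as `S_N16 (RRec₁₃Sep 𝔯)` -/

section ConstLayer

variable (𝔯 : RateReading₁₃Sep N) (o : T4Family → NE3Objects₁₁ N)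
  (hconst : ∀ (F : T4Family) (θ : Stage13Params F N) (hP : θ.Provisos₁₃Sep F N) (g₀ : ℕ → ℝ) (os : List (ULoop F)) (k : ℕ), (𝔯.lit F θ hP g₀ os).ne3 k = o F)
  {F : T4Family} (hreg : InEndRegime (ne3OfRecord₁₁ F (o F)))
  (hbs : 512 * (4 + 1) * (4 + 4) * (F.L : ℝ) ^ 2 * (o F).b ≤ 1) (hΛ₂' : 0 < (o F).Λ₂') {ε' cg : ℝ} (hε' : 0 < ε') (hcg : 0 ≤ cg)
  {ι σA σB : Type*} {l₀ : ℝ} {T : ℕ → Finset ι} {A B shA shB : ℕ → ℝ → ι → ℝ}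
  {SA : ℕ → Finset σA} {SB : ℕ → Finset σB} {pieceA : ℕ → ℝ → σA → ι → ℝ} {pieceB : ℕ → ℝ → σB → ι → ℝ}
  {lvlA : ℕ → σA → ℕ} {lvlB : ℕ → σB → ℕ} {DA ρA DB ρB τA τB : ℕ → ℝ} {N₁ : ℕ} {νbar Dbar : ℝ}
  (hLA : LevelLedger l₀ T A shA SA pieceA lvlA DA ρA) (hLB : LevelLedger l₀ T B shB SB pieceB lvlB DB ρB)
  (hwA : LiveWindow SA lvlA N₁ νbar) (hwB : LiveWindow SB lvlB N₁ νbar) (hDA : ∀ j, DA j ≤ Dbar) (hDB : ∀ j, DB j ≤ Dbar)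
  (hdictA : ∀ j, 1 ≤ j → ∀ x : ℝ,
    (∀ (V UA UB : B7Prop1Explicit.Site 4 → Fin 4 → (Matrix (Fin N) (Fin N) ℂ)ˣ) (z : B7Prop1Explicit.Site 4) (μ ν : Fin 4) (t : ℝ),
      V ∈ (o F).dom → IsMinimiser 4 (sfClass 4 F.L (o F).Nper (o F).ε) F.L (o F).Nper j V UA →
      IsMinimiser 4 (sfClass 4 F.L (o F).Nper (o F).ε) F.L (o F).Nper (j + 1) V UB → Regular 4 F.L (o F).Nper (o F).b (o F).g (j + 1) UB →
      ε' * ((F.L : ℝ)⁻¹) ^ (2 * j) ≤ t →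
      |‖((hol UA z (plaqWord μ ν) : (Matrix (Fin N) (Fin N) ℂ)ˣ) : Matrix (Fin N) (Fin N) ℂ) - 1‖
          - ‖((hol (rescale F.L (bavg F.L UB)) z (plaqWord μ ν) : (Matrix (Fin N) (Fin N) ℂ)ˣ) : Matrix (Fin N) (Fin N) ℂ) - 1‖| / t ≤ x) →
    ρA j ≤ x + τA j)
  (hdictB : ∀ j, 1 ≤ j → ∀ x : ℝ,
    (∀ (V UA UB : B7Prop1Explicit.Site 4 → Fin 4 → (Matrix (Fin N) (Fin N) ℂ)ˣ) (z : B7Prop1Explicit.Site 4) (π : Plane 4)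
      (r₀ : Fin 4 → Fin F.L) (i₀ j₀ : ℕ) (t : ℝ),
      V ∈ (o F).dom → IsMinimiser 4 (sfClass 4 F.L (o F).Nper (o F).ε) F.L (o F).Nper j V UA →
      IsMinimiser 4 (sfClass 4 F.L (o F).Nper (o F).ε) F.L (o F).Nper (j + 1) V UB → Regular 4 F.L (o F).Nper (o F).b (o F).g (j + 1) UB →
      RegularSup 4 F.L (o F).Nper (o F).b cg (j + 1) UB → i₀ < F.L → j₀ < F.L → ε' * ((F.L : ℝ)⁻¹) ^ (2 * j) ≤ t →
      |‖((hol UA z (plaqWord π.1.1 π.1.2) : (Matrix (Fin N) (Fin N) ℂ)ˣ) : Matrix (Fin N) (Fin N) ℂ) - 1‖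
          - (F.L : ℝ) ^ 2 * ‖((hol UB ((F.L : ℤ) • z + boxVec F.L r₀ + (i₀ : ℤ) • e π.1.1 + (j₀ : ℤ) • e π.1.2)
              (plaqWord π.1.1 π.1.2) : (Matrix (Fin N) (Fin N) ℂ)ˣ) : Matrix (Fin N) (Fin N) ℂ) - 1‖| / t ≤ x) →
    ρB j ≤ x + τB j)

include hconst hreg hbs hΛ₂' hε' hcg hLA hLB hwA hwB hDA hDB hdictA hdictB

/-- **NE7c AT EXPLICIT CARRIERS AT A CONSTANT NE3 LAYER OF THE STAGE-13 HOME, THE IN-EDGE N16 BY NAME.**  DATA: a Stage-13 rate reading `𝔯` whose NE3 component is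
constantly `o F` (`hconst`); the K4 stub `hS : S_N16 (RRec₁₃Sep 𝔯)`; a datum key `h : IsDatumOfRecord₁₃CSep F N D` of the family; THE END's proviso `InEndRegime` at the layer;
the regularity numeral and `0 < Λ₂′`; `ε′ > 0`, `cg ≥ 0`; explicit carriers `(l₀, T, A, B, shA, shB)` with two LEVEL LEDGERS ([dict] + (M1)), LIVE WINDOWS (N20), `D ≤ D̄`
(N12); threshold widths `τA, τB ≤ c₂ϑ₂^j` (`0 ≤ c₂`, `0 ≤ ϑ₂ < 1`); the two [dict] clauses at the layer.  CONCLUSION: `∃ ϑ C, 0 < ϑ < 1 ∧ 0 ≤ C ∧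
ShellWeightBound l₀ T A B shA shB (K ↦ C·ϑ^K)` — module 8's `shellWeightBound_geometric_of_constLayer_inEndRegime` with `h16 := n16At_of_s_N16_rRec₁₃Sep_constLayer 𝔯 o
hconst hS F h`.  CONDITIONAL on every displayed binder; NE7c NOT proved; N21 NOT discharged. [folklore] -/
theorem shellWeightBound_geometric_of_rRec₁₃Sep_constLayer_inEndRegime (hS : S_N16 (RRec₁₃Sep 𝔯)) {D : Datum F N} (h : IsDatumOfRecord₁₃CSep F N D)
    {c₂ ϑ₂ : ℝ} (hc₂ : 0 ≤ c₂) (h₂ : 0 ≤ ϑ₂) (h₂' : ϑ₂ < 1) (hτA : ∀ j, τA j ≤ c₂ * ϑ₂ ^ j) (hτB : ∀ j, τB j ≤ c₂ * ϑ₂ ^ j) :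
    ∃ ϑ C : ℝ, 0 < ϑ ∧ ϑ < 1 ∧ 0 ≤ C ∧ ShellWeightBound l₀ T A B shA shB fun K => C * ϑ ^ K :=
  shellWeightBound_geometric_of_constLayer_inEndRegime (n16At_of_s_N16_rRec₁₃Sep_constLayer 𝔯 o hconst hS F h) hbs hΛ₂' hε' hcg hLA hLB hwA hwB
    hDA hDB hdictA hdictB hreg hc₂ h₂ h₂' hτA hτB

/-- **THE SAME AT THE REGIME-RESTRICTED STAGE-13 HOME `RRec₁₃SepOn 𝔯 Rg`** (new at Stage 13; the K3‴ item's own guard is `Rg F θ := θ.ZtUnity F N ∧ θ.SlotsNondegenerate₁₃ F N`): the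
K4 stub `S_N16 (RRec₁₃SepOn 𝔯 Rg)` at a GUARDED admissible tuple `(θ, hP, hRg, hθ)` of the family delivers `N16At (ne3OfRecord₁₁ F (o F))` (dag-n16-e
`n16At_of_s_N16_rRec₁₃SepOn_constLayer`), hence the same geometric `ShellWeightBound` at the explicit carriers.  CONDITIONAL; NE7c NOT proved. [folklore] -/
theorem shellWeightBound_geometric_of_rRec₁₃SepOn_constLayer_inEndRegime (Rg : (F : T4Family) → Stage13Params F N → Prop) (hS : S_N16 (RRec₁₃SepOn 𝔯 Rg))
    {θ : Stage13Params F N} (hP : θ.Provisos₁₃Sep F N) (hRg : Rg F θ) (hθ : θ.Admissible F N)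
    {c₂ ϑ₂ : ℝ} (hc₂ : 0 ≤ c₂) (h₂ : 0 ≤ ϑ₂) (h₂' : ϑ₂ < 1) (hτA : ∀ j, τA j ≤ c₂ * ϑ₂ ^ j) (hτB : ∀ j, τB j ≤ c₂ * ϑ₂ ^ j) :
    ∃ ϑ C : ℝ, 0 < ϑ ∧ ϑ < 1 ∧ 0 ≤ C ∧ ShellWeightBound l₀ T A B shA shB fun K => C * ϑ ^ K :=
  shellWeightBound_geometric_of_constLayer_inEndRegime (n16At_of_s_N16_rRec₁₃SepOn_constLayer 𝔯 Rg o hconst hS F hP hRg hθ) hbs hΛ₂' hε' hcg hLA hLB hwA hwB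
    hDA hDB hdictA hdictB hreg hc₂ h₂ h₂' hτA hτB

/-- **THE SAME, THRESHOLD WIDTHS BY NAME FROM NODE U2 AT THE DATUM, IN THE RECORD's OWN COUPLING WINDOW.**  As above, the rate of the threshold widths supplied by node
U2's `U2Output D g₀ Cout θ₂` (`0 ≤ θ₂ < 1`), a bare sequence tuned in the record's window `D.Tuned h.params.γ g g₀`, the smallness `(1 + p₀∕log γ⁻²)γ²Cout ≤ 1∕2` at
`γ = h.params.γ`, `ν = h.params.ν`, and the two [dict-thr] clauses against the thresholds of record along the matched runs; `0 ≤ ν.A₀` (module 7 §1) and `γ < 1` (RR-2's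
`IsDatumOfRecord₁₃CSep.gamma_lt_one`) READ OFF the key — module 8's `shellWeightBound_geometric_of_constLayer_u2Output`.  CONDITIONAL; NE7c NOT proved. [folklore] -/
theorem shellWeightBound_geometric_of_rRec₁₃Sep_constLayer_u2Output (hS : S_N16 (RRec₁₃Sep 𝔯)) {D : Datum F N} (h : IsDatumOfRecord₁₃CSep F N D)
    (g₀ : ℕ → ℝ) {Cout θ₂ g : ℝ} (hU2 : U2Output D g₀ Cout θ₂) (h₂ : 0 ≤ θ₂) (h₂' : θ₂ < 1) (ht : D.Tuned h.params.γ g g₀) (hsmall : (1 + h.params.ν.p₀ / Real.log (h.params.γ ^ 2)⁻¹) * h.params.γ ^ 2 * Cout ≤ 1 / 2)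
    (hthrA : ∀ j, ∀ x : ℝ, (∀ K, j ≤ K →
      |epsOfRecord h.params.ν (runFlow D g₀ K) j - epsOfRecord h.params.ν (runFlow D g₀ (K + 1)) (j + 1)| ≤
        x * epsOfRecord h.params.ν (runFlow D g₀ K) j) → τA j ≤ x)
    (hthrB : ∀ j, ∀ x : ℝ, (∀ K, j ≤ K →
      |epsOfRecord h.params.ν (runFlow D g₀ K) j - epsOfRecord h.params.ν (runFlow D g₀ (K + 1)) (j + 1)| ≤
        x * epsOfRecord h.params.ν (runFlow D g₀ (K + 1)) (j + 1)) → τB j ≤ x) :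
    ∃ ϑ C : ℝ, 0 < ϑ ∧ ϑ < 1 ∧ 0 ≤ C ∧ ShellWeightBound l₀ T A B shA shB fun K => C * ϑ ^ K :=
  shellWeightBound_geometric_of_constLayer_u2Output (n16At_of_s_N16_rRec₁₃Sep_constLayer 𝔯 o hconst hS F h) hbs hΛ₂' hε' hcg hLA hLB hwA hwB hDA hDB
    hdictA hdictB hreg h.params.ν (nu_A0_pos_of_isDatumOfRecord₁₃CSep h).le D g₀ hU2 h₂ h₂' h.gamma_lt_one (box_and_pin_of_tuned D ht).1 hsmall hthrA hthrB

end ConstLayer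

/-! ## §2 At node00-def-RR-1's pinned NE3 object of record `Node00.ne3ConstLayerOfRecord₁₁ F N (ℓ F)` -/

section OfRecord

variable (𝔯 : RateReading₁₃Sep N) (ℓ : T4Family → NE3Letters₁₁)
  (hconst : ∀ (F : T4Family) (θ : Stage13Params F N) (hP : θ.Provisos₁₃Sep F N) (g₀ : ℕ → ℝ) (os : List (ULoop F)) (k : ℕ),
    (𝔯.lit F θ hP g₀ os).ne3 k = ne3ConstLayerOfRecord₁₁ F N (ℓ F))
  {F : T4Family} (hreg : InEndRegime (ne3OfRecord₁₁ F (ne3ConstLayerOfRecord₁₁ F N (ℓ F))))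
  (hbs : 512 * (4 + 1) * (4 + 4) * (F.L : ℝ) ^ 2 * (ℓ F).b ≤ 1) (hΛ₂' : 0 < (ℓ F).Λ₂') {ε' cg : ℝ} (hε' : 0 < ε') (hcg : 0 ≤ cg)
  {ι σA σB : Type*} {l₀ : ℝ} {T : ℕ → Finset ι} {A B shA shB : ℕ → ℝ → ι → ℝ}
  {SA : ℕ → Finset σA} {SB : ℕ → Finset σB} {pieceA : ℕ → ℝ → σA → ι → ℝ} {pieceB : ℕ → ℝ → σB → ι → ℝ}
  {lvlA : ℕ → σA → ℕ} {lvlB : ℕ → σB → ℕ} {DA ρA DB ρB τA τB : ℕ → ℝ} {N₁ : ℕ} {νbar Dbar : ℝ}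
  (hLA : LevelLedger l₀ T A shA SA pieceA lvlA DA ρA) (hLB : LevelLedger l₀ T B shB SB pieceB lvlB DB ρB)
  (hwA : LiveWindow SA lvlA N₁ νbar) (hwB : LiveWindow SB lvlB N₁ νbar) (hDA : ∀ j, DA j ≤ Dbar) (hDB : ∀ j, DB j ≤ Dbar)
  (hdictA : ∀ j, 1 ≤ j → ∀ x : ℝ,
    (∀ (V UA UB : B7Prop1Explicit.Site 4 → Fin 4 → (Matrix (Fin N) (Fin N) ℂ)ˣ) (z : B7Prop1Explicit.Site 4) (μ ν : Fin 4) (t : ℝ),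
      V ∈ (ne3ConstLayerOfRecord₁₁ F N (ℓ F)).dom →
      IsMinimiser 4 (sfClass 4 F.L (2 * F.L ^ F.m) (ℓ F).ε) F.L (2 * F.L ^ F.m) j V UA →
      IsMinimiser 4 (sfClass 4 F.L (2 * F.L ^ F.m) (ℓ F).ε) F.L (2 * F.L ^ F.m) (j + 1) V UB → Regular 4 F.L (2 * F.L ^ F.m) (ℓ F).b (ℓ F).g (j + 1) UB →
      ε' * ((F.L : ℝ)⁻¹) ^ (2 * j) ≤ t →
      |‖((hol UA z (plaqWord μ ν) : (Matrix (Fin N) (Fin N) ℂ)ˣ) : Matrix (Fin N) (Fin N) ℂ) - 1‖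
          - ‖((hol (rescale F.L (bavg F.L UB)) z (plaqWord μ ν) : (Matrix (Fin N) (Fin N) ℂ)ˣ) : Matrix (Fin N) (Fin N) ℂ) - 1‖| / t ≤ x) →
    ρA j ≤ x + τA j)
  (hdictB : ∀ j, 1 ≤ j → ∀ x : ℝ,
    (∀ (V UA UB : B7Prop1Explicit.Site 4 → Fin 4 → (Matrix (Fin N) (Fin N) ℂ)ˣ) (z : B7Prop1Explicit.Site 4) (π : Plane 4)
      (r₀ : Fin 4 → Fin F.L) (i₀ j₀ : ℕ) (t : ℝ),
      V ∈ (ne3ConstLayerOfRecord₁₁ F N (ℓ F)).dom →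
      IsMinimiser 4 (sfClass 4 F.L (2 * F.L ^ F.m) (ℓ F).ε) F.L (2 * F.L ^ F.m) j V UA →
      IsMinimiser 4 (sfClass 4 F.L (2 * F.L ^ F.m) (ℓ F).ε) F.L (2 * F.L ^ F.m) (j + 1) V UB → Regular 4 F.L (2 * F.L ^ F.m) (ℓ F).b (ℓ F).g (j + 1) UB →
      RegularSup 4 F.L (2 * F.L ^ F.m) (ℓ F).b cg (j + 1) UB → i₀ < F.L → j₀ < F.L → ε' * ((F.L : ℝ)⁻¹) ^ (2 * j) ≤ t →
      |‖((hol UA z (plaqWord π.1.1 π.1.2) : (Matrix (Fin N) (Fin N) ℂ)ˣ) : Matrix (Fin N) (Fin N) ℂ) - 1‖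
          - (F.L : ℝ) ^ 2 * ‖((hol UB ((F.L : ℤ) • z + boxVec F.L r₀ + (i₀ : ℤ) • e π.1.1 + (j₀ : ℤ) • e π.1.2)
              (plaqWord π.1.1 π.1.2) : (Matrix (Fin N) (Fin N) ℂ)ˣ) : Matrix (Fin N) (Fin N) ℂ) - 1‖| / t ≤ x) →
    ρB j ≤ x + τB j)

include hconst hreg hbs hΛ₂' hε' hcg hLA hLB hwA hwB hDA hDB hdictA hdictB

/-- **NE7c AT EXPLICIT CARRIERS AT THE NE3 OBJECT OF RECORD** — §1 at `o F := Node00.ne3ConstLayerOfRecord₁₁ F N (ℓ F)`: the PHYSICAL unit torus `Nper = 2·L^m` with ALL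
`2·L^m`-periodic `SU(N)` unit-lattice data (RR-1's `ne3ConstLayerOfRecord₁₁_Nper`, `mem_ne3ConstLayerOfRecord₁₁_dom_iff`) and THE END's letters `ℓ F`; the numerals at
letter level; the [dict] clauses against the (42)-constrained minimisers on that torus.  For RR-1's constant reading `ne3ConstReadingOfRecord₁₁ F N (ℓ F)` the binder
`hconst` is `fun … ↦ rfl`.  CONDITIONAL on every displayed binder; NE7c NOT proved; N21 NOT discharged. [folklore] -/
theorem shellWeightBound_geometric_of_rRec₁₃Sep_ofRecord_inEndRegime (hS : S_N16 (RRec₁₃Sep 𝔯)) {D : Datum F N} (h : IsDatumOfRecord₁₃CSep F N D)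
    {c₂ ϑ₂ : ℝ} (hc₂ : 0 ≤ c₂) (h₂ : 0 ≤ ϑ₂) (h₂' : ϑ₂ < 1) (hτA : ∀ j, τA j ≤ c₂ * ϑ₂ ^ j) (hτB : ∀ j, τB j ≤ c₂ * ϑ₂ ^ j) :
    ∃ ϑ C : ℝ, 0 < ϑ ∧ ϑ < 1 ∧ 0 ≤ C ∧ ShellWeightBound l₀ T A B shA shB fun K => C * ϑ ^ K := by
  have hN : (ne3ConstLayerOfRecord₁₁ F N (ℓ F)).Nper = 2 * F.L ^ F.m := Node00.ne3ConstLayerOfRecord₁₁_Nper F N (ℓ F)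
  refine shellWeightBound_geometric_of_rRec₁₃Sep_constLayer_inEndRegime 𝔯 (fun F => ne3ConstLayerOfRecord₁₁ F N (ℓ F)) hconst hreg hbs hΛ₂' hε' hcg
    hLA hLB hwA hwB hDA hDB ?_ ?_ hS h hc₂ h₂ h₂' hτA hτB
  · intro j hj x hx
    refine hdictA j hj x fun V UA UB z μ ν t hV hA hB hr ht => ?_
    rw [← hN] at hA hB hr
    exact hx V UA UB z μ ν t hV hA hB hr ht
  · intro j hj x hx
    refine hdictB j hj x fun V UA UB z π r₀ i₀ j₀ t hV hA hB hr hsup hi₀ hj₀ ht => ?_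
    rw [← hN] at hA hB hr hsup
    exact hx V UA UB z π r₀ i₀ j₀ t hV hA hB hr hsup hi₀ hj₀ ht

/-- **THE SAME WITH NODE U2's THRESHOLD WIDTHS BY NAME AT THE DATUM** (§1's `…_u2Output` at the object of record). [folklore] -/
theorem shellWeightBound_geometric_of_rRec₁₃Sep_ofRecord_u2Output (hS : S_N16 (RRec₁₃Sep 𝔯)) {D : Datum F N} (h : IsDatumOfRecord₁₃CSep F N D)
    (g₀ : ℕ → ℝ) {Cout θ₂ g : ℝ} (hU2 : U2Output D g₀ Cout θ₂) (h₂ : 0 ≤ θ₂) (h₂' : θ₂ < 1) (ht : D.Tuned h.params.γ g g₀) (hsmall : (1 + h.params.ν.p₀ / Real.log (h.params.γ ^ 2)⁻¹) * h.params.γ ^ 2 * Cout ≤ 1 / 2)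
    (hthrA : ∀ j, ∀ x : ℝ, (∀ K, j ≤ K →
      |epsOfRecord h.params.ν (runFlow D g₀ K) j - epsOfRecord h.params.ν (runFlow D g₀ (K + 1)) (j + 1)| ≤
        x * epsOfRecord h.params.ν (runFlow D g₀ K) j) → τA j ≤ x)
    (hthrB : ∀ j, ∀ x : ℝ, (∀ K, j ≤ K →
      |epsOfRecord h.params.ν (runFlow D g₀ K) j - epsOfRecord h.params.ν (runFlow D g₀ (K + 1)) (j + 1)| ≤
        x * epsOfRecord h.params.ν (runFlow D g₀ (K + 1)) (j + 1)) → τB j ≤ x) :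
    ∃ ϑ C : ℝ, 0 < ϑ ∧ ϑ < 1 ∧ 0 ≤ C ∧ ShellWeightBound l₀ T A B shA shB fun K => C * ϑ ^ K := by
  have hN : (ne3ConstLayerOfRecord₁₁ F N (ℓ F)).Nper = 2 * F.L ^ F.m := Node00.ne3ConstLayerOfRecord₁₁_Nper F N (ℓ F)
  refine shellWeightBound_geometric_of_rRec₁₃Sep_constLayer_u2Output 𝔯 (fun F => ne3ConstLayerOfRecord₁₁ F N (ℓ F)) hconst hreg hbs hΛ₂' hε' hcg
    hLA hLB hwA hwB hDA hDB ?_ ?_ hS h g₀ hU2 h₂ h₂' ht hsmall hthrA hthrB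
  · intro j hj x hx
    refine hdictA j hj x fun V UA UB z μ ν t hV hA hB hr ht => ?_
    rw [← hN] at hA hB hr
    exact hx V UA UB z μ ν t hV hA hB hr ht
  · intro j hj x hx
    refine hdictB j hj x fun V UA UB z π r₀ i₀ j₀ t hV hA hB hr hsup hi₀ hj₀ ht => ?_
    rw [← hN] at hA hB hr hsup
    exact hx V UA UB z π r₀ i₀ j₀ t hV hA hB hr hsup hi₀ hj₀ ht

end OfRecord

/-! ## §3 The K5 face: an ∃-weight certificate for a spine reading from the constant layer and the term-object readings -/

section KeyedFace

variable (cr : SpineReading₁₃Sep N) (𝔯 : RateReading₁₃Sep N) (o : T4Family → NE3Objects₁₁ N)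
  (hconst : ∀ (F : T4Family) (θ : Stage13Params F N) (hP : θ.Provisos₁₃Sep F N) (g₀ : ℕ → ℝ) (os : List (ULoop F)) (k : ℕ), (𝔯.lit F θ hP g₀ os).ne3 k = o F)
  (hS : S_N16 (RRec₁₃Sep 𝔯)) (hreg : ∀ F : T4Family, InEndRegime (ne3OfRecord₁₁ F (o F)))
  (hnum : ∀ F : T4Family, 512 * (4 + 1) * (4 + 4) * (F.L : ℝ) ^ 2 * (o F).b ≤ 1 ∧ 0 < (o F).Λ₂')
  (hread : ∀ (F : T4Family) (θ : Stage13Params F N) (hP : θ.Provisos₁₃Sep F N), θ.Admissible F N → ∀ (g₀ : ℕ → ℝ) (os : List (ULoop F)),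
    ∃ (ε' cg : ℝ) (σA σB : Type) (SA : ℕ → Finset σA) (SB : ℕ → Finset σB) (pieceA : ℕ → ℝ → σA → (cr F θ hP g₀ os).ι → ℝ)
      (pieceB : ℕ → ℝ → σB → (cr F θ hP g₀ os).ι → ℝ) (lvlA : ℕ → σA → ℕ) (lvlB : ℕ → σB → ℕ) (DA ρA DB ρB τA τB : ℕ → ℝ) (N₁ : ℕ)
      (νbar Dbar c₂ ϑ₂ : ℝ),
      0 < ε' ∧ 0 ≤ cg ∧
      LevelLedger (cr F θ hP g₀ os).l₀ (cr F θ hP g₀ os).T (cr F θ hP g₀ os).A (cr F θ hP g₀ os).shA SA pieceA lvlA DA ρA ∧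
      LevelLedger (cr F θ hP g₀ os).l₀ (cr F θ hP g₀ os).T (cr F θ hP g₀ os).B (cr F θ hP g₀ os).shB SB pieceB lvlB DB ρB ∧
      LiveWindow SA lvlA N₁ νbar ∧ LiveWindow SB lvlB N₁ νbar ∧ (∀ j, DA j ≤ Dbar) ∧ (∀ j, DB j ≤ Dbar) ∧
      0 ≤ c₂ ∧ 0 ≤ ϑ₂ ∧ ϑ₂ < 1 ∧ (∀ j, τA j ≤ c₂ * ϑ₂ ^ j) ∧ (∀ j, τB j ≤ c₂ * ϑ₂ ^ j) ∧
      (∀ j, 1 ≤ j → ∀ x : ℝ,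
        (∀ (V UA UB : B7Prop1Explicit.Site 4 → Fin 4 → (Matrix (Fin N) (Fin N) ℂ)ˣ) (z : B7Prop1Explicit.Site 4) (μ ν : Fin 4) (t : ℝ),
          V ∈ (o F).dom → IsMinimiser 4 (sfClass 4 F.L (o F).Nper (o F).ε) F.L (o F).Nper j V UA →
          IsMinimiser 4 (sfClass 4 F.L (o F).Nper (o F).ε) F.L (o F).Nper (j + 1) V UB → Regular 4 F.L (o F).Nper (o F).b (o F).g (j + 1) UB →
          ε' * ((F.L : ℝ)⁻¹) ^ (2 * j) ≤ t →
          |‖((hol UA z (plaqWord μ ν) : (Matrix (Fin N) (Fin N) ℂ)ˣ) : Matrix (Fin N) (Fin N) ℂ) - 1‖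
              - ‖((hol (rescale F.L (bavg F.L UB)) z (plaqWord μ ν) : (Matrix (Fin N) (Fin N) ℂ)ˣ) : Matrix (Fin N) (Fin N) ℂ) - 1‖| / t ≤ x) →
        ρA j ≤ x + τA j) ∧
      (∀ j, 1 ≤ j → ∀ x : ℝ,
        (∀ (V UA UB : B7Prop1Explicit.Site 4 → Fin 4 → (Matrix (Fin N) (Fin N) ℂ)ˣ) (z : B7Prop1Explicit.Site 4) (π : Plane 4)
          (r₀ : Fin 4 → Fin F.L) (i₀ j₀ : ℕ) (t : ℝ),
          V ∈ (o F).dom → IsMinimiser 4 (sfClass 4 F.L (o F).Nper (o F).ε) F.L (o F).Nper j V UA →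
          IsMinimiser 4 (sfClass 4 F.L (o F).Nper (o F).ε) F.L (o F).Nper (j + 1) V UB → Regular 4 F.L (o F).Nper (o F).b (o F).g (j + 1) UB →
          RegularSup 4 F.L (o F).Nper (o F).b cg (j + 1) UB → i₀ < F.L → j₀ < F.L → ε' * ((F.L : ℝ)⁻¹) ^ (2 * j) ≤ t →
          |‖((hol UA z (plaqWord π.1.1 π.1.2) : (Matrix (Fin N) (Fin N) ℂ)ˣ) : Matrix (Fin N) (Fin N) ℂ) - 1‖
              - (F.L : ℝ) ^ 2 * ‖((hol UB ((F.L : ℤ) • z + boxVec F.L r₀ + (i₀ : ℤ) • e π.1.1 + (j₀ : ℤ) • e π.1.2)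
                  (plaqWord π.1.1 π.1.2) : (Matrix (Fin N) (Fin N) ℂ)ˣ) : Matrix (Fin N) (Fin N) ℂ) - 1‖| / t ≤ x) →
        ρB j ≤ x + τB j))

include hconst hS hreg hnum hread

/-- **THE K5 FACE OF N21 FROM THE CONSTANT LAYER — AN ∃-WEIGHT CERTIFICATE AT EVERY ADMISSIBLE STAGE-13 TUPLE.**  DATA: a spine reading `cr`; a rate reading `𝔯` with
constant NE3 component `o F` (`hconst`) carrying the K4 stub `S_N16 (RRec₁₃Sep 𝔯)`; THE END's proviso `InEndRegime` at the layer of every family; the regularity numeral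
and `0 < Λ₂′`; and, at every admissible tuple with provisos and every `(g₀, os)`, NODE O's TERM-OBJECT READINGS of the carriers `cr F θ hP g₀ os` (`hread`: a threshold
unit `ε′ > 0`, a flux letter `cg ≥ 0`, two LEVEL LEDGERS ([dict] + (M1)), LIVE WINDOWS, `D ≤ D̄`, threshold widths at a geometric rate, the two [dict] clauses at `o F`).
CONCLUSION: for every admissible Stage-13 tuple with provisos and every `(g₀, os)`, SOME weight `Wsh` with `ShellWeightBound (cr F θ hP g₀ os) … Wsh` — module 9's
`hW`; the datum key is RR-2's `isDatumOfRecord₁₃CSep_datumOfRecord₁₃Sep`, the bound §1's.  CONDITIONAL on every displayed binder; NE7c NOT proved; N21 NOT discharged.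
[folklore] -/
theorem exists_shellWeight_keyed₁₃Sep_of_constLayer (F : T4Family) (θ : Stage13Params F N) (hP : θ.Provisos₁₃Sep F N) (hθ : θ.Admissible F N) (g₀ : ℕ → ℝ)
    (os : List (ULoop F)) :
    ∃ Wsh : ℕ → ℝ, ShellWeightBound (cr F θ hP g₀ os).l₀ (cr F θ hP g₀ os).T (cr F θ hP g₀ os).A (cr F θ hP g₀ os).B (cr F θ hP g₀ os).shA
      (cr F θ hP g₀ os).shB Wsh := by
  obtain ⟨ε', cg, σA, σB, SA, SB, pieceA, pieceB, lvlA, lvlB, DA, ρA, DB, ρB, τA, τB, N₁, νbar, Dbar, c₂, ϑ₂, hε', hcg, hLA, hLB, hwA, hwB, hDA, hDB,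
    hc₂, h₂, h₂', hτA, hτB, hdictA, hdictB⟩ := hread F θ hP hθ g₀ os
  obtain ⟨ϑ, C, -, -, -, hSW⟩ := shellWeightBound_geometric_of_rRec₁₃Sep_constLayer_inEndRegime 𝔯 o hconst (hreg F) (hnum F).1 (hnum F).2 hε' hcg hLA hLB
    hwA hwB hDA hDB hdictA hdictB hS (isDatumOfRecord₁₃CSep_datumOfRecord₁₃Sep F N θ hP hθ) hc₂ h₂ h₂' hτA hτB
  exact ⟨_, hSW⟩

/-! ## §4 The composite knit at the homes with the N21 slot discharged down to its displayed binders -/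

/-- **N27 = B5 AT THE STAGE-13 RECORD FROM THE HOMES, THE N21 SLOT SUPPLIED BY THE CONSTANT LAYER.**  dag-n27-c XXVII's `spine_rec13CSep_of_homes₁₃Sep` — the six K4 stubs at
`RRec₁₃Sep 𝔯` (N16's `h16 := hS` SERVING TWICE: as the K4 stub and as N21's in-edge), `S_N27x ₁₂C (SRec₁₃Sep cr)`, `S_N20 (SRec₁₃Sep cr)`, the home-keyed N19′ edge `h19` — with the
N21 slot `S_N21 (SRec₁₃Sep ·)` DISCHARGED through module 9's `spine_rec13CSep_of_homes₁₃Sep_existsShellWeight` by §3: what N21 contributes to the hypothesis list is `hconst`, THE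
END's proviso at the layer, the two numerals and NODE O's term-object readings `hread` (§3) — nothing else.  CONCLUSION `Spine ₁₃C`.  Every binder a HYPOTHESIS (0∕1 today);
N21 ∕ N27 NOT discharged; K3′ NOT claimed. [bookkeeping] -/
theorem spine_rec13CSep_of_homes₁₃Sep_constLayer (h14 : S_N14 (RRec₁₃Sep 𝔯)) (h15 : S_N15 (RRec₁₃Sep 𝔯)) (h17 : S_N17 (RRec₁₃Sep 𝔯)) (h18 : S_N18 (RRec₁₃Sep 𝔯))
    (h22 : S_N22 (RRec₁₃Sep 𝔯)) (hx' : S_N27x (fun F D w => IsRecordOfRecord₁₃CSep F N D w) (SRec₁₃Sep cr)) (h20 : S_N20 (SRec₁₃Sep cr))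
    (h19 : ∀ (F : T4Family) (θ : Stage13Params F N) (hP : θ.Provisos₁₃Sep F N), θ.Admissible F N → ∀ (g₀ : ℕ → ℝ) (os : List (ULoop F))
      (h : IsDatumOfRecord₁₃CSep F N (datumOfRecord₁₃Sep F N θ hP)) (k : ℕ),
      RatesAt (datumOfRecord₁₃Sep F N θ hP) (rateCarriersOfRecord₁₃Sep 𝔯 F h.params h.provisos g₀ os k) → letI := (cr F θ hP g₀ os).dec
        ∃ δ : ℕ → ℝ, NE7.Core (cr F θ hP g₀ os).l₀ (cr F θ hP g₀ os).vol (cr F θ hP g₀ os).T (cr F θ hP g₀ os).Bad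
          (fun K t τ => (cr F θ hP g₀ os).A K t τ - (cr F θ hP g₀ os).shA K t τ) (fun K t τ => (cr F θ hP g₀ os).B K t τ - (cr F θ hP g₀ os).shB K t τ) δ ∧
          Summable δ) :
    Spine (N := N) fun F D w => IsRecordOfRecord₁₃CSep F N D w :=
  spine_rec13CSep_of_homes₁₃Sep_existsShellWeight cr 𝔯 h14 h15 hS h17 h18 h22 hx' h20
    (fun F θ hP hθ g₀ os => exists_shellWeight_keyed₁₃Sep_of_constLayer cr 𝔯 o hconst hS hreg hnum hread F θ hP hθ g₀ os) h19

end KeyedFace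

/-! ## §3b The K5 face at the regime-restricted home (θ-form, guarded) -/

section KeyedFaceOn

variable (cr : SpineReading₁₃Sep N) (𝔯 : RateReading₁₃Sep N) (Rg : (F : T4Family) → Stage13Params F N → Prop) (o : T4Family → NE3Objects₁₁ N)
  (hconst : ∀ (F : T4Family) (θ : Stage13Params F N) (hP : θ.Provisos₁₃Sep F N) (g₀ : ℕ → ℝ) (os : List (ULoop F)) (k : ℕ), (𝔯.lit F θ hP g₀ os).ne3 k = o F)
  (hS : S_N16 (RRec₁₃SepOn 𝔯 Rg)) (hreg : ∀ F : T4Family, InEndRegime (ne3OfRecord₁₁ F (o F)))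
  (hnum : ∀ F : T4Family, 512 * (4 + 1) * (4 + 4) * (F.L : ℝ) ^ 2 * (o F).b ≤ 1 ∧ 0 < (o F).Λ₂')
  (hread : ∀ (F : T4Family) (θ : Stage13Params F N) (hP : θ.Provisos₁₃Sep F N), Rg F θ → θ.Admissible F N → ∀ (g₀ : ℕ → ℝ) (os : List (ULoop F)),
    ∃ (ε' cg : ℝ) (σA σB : Type) (SA : ℕ → Finset σA) (SB : ℕ → Finset σB) (pieceA : ℕ → ℝ → σA → (cr F θ hP g₀ os).ι → ℝ)
      (pieceB : ℕ → ℝ → σB → (cr F θ hP g₀ os).ι → ℝ) (lvlA : ℕ → σA → ℕ) (lvlB : ℕ → σB → ℕ) (DA ρA DB ρB τA τB : ℕ → ℝ) (N₁ : ℕ)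
      (νbar Dbar c₂ ϑ₂ : ℝ),
      0 < ε' ∧ 0 ≤ cg ∧
      LevelLedger (cr F θ hP g₀ os).l₀ (cr F θ hP g₀ os).T (cr F θ hP g₀ os).A (cr F θ hP g₀ os).shA SA pieceA lvlA DA ρA ∧
      LevelLedger (cr F θ hP g₀ os).l₀ (cr F θ hP g₀ os).T (cr F θ hP g₀ os).B (cr F θ hP g₀ os).shB SB pieceB lvlB DB ρB ∧
      LiveWindow SA lvlA N₁ νbar ∧ LiveWindow SB lvlB N₁ νbar ∧ (∀ j, DA j ≤ Dbar) ∧ (∀ j, DB j ≤ Dbar) ∧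
      0 ≤ c₂ ∧ 0 ≤ ϑ₂ ∧ ϑ₂ < 1 ∧ (∀ j, τA j ≤ c₂ * ϑ₂ ^ j) ∧ (∀ j, τB j ≤ c₂ * ϑ₂ ^ j) ∧
      (∀ j, 1 ≤ j → ∀ x : ℝ,
        (∀ (V UA UB : B7Prop1Explicit.Site 4 → Fin 4 → (Matrix (Fin N) (Fin N) ℂ)ˣ) (z : B7Prop1Explicit.Site 4) (μ ν : Fin 4) (t : ℝ),
          V ∈ (o F).dom → IsMinimiser 4 (sfClass 4 F.L (o F).Nper (o F).ε) F.L (o F).Nper j V UA →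
          IsMinimiser 4 (sfClass 4 F.L (o F).Nper (o F).ε) F.L (o F).Nper (j + 1) V UB → Regular 4 F.L (o F).Nper (o F).b (o F).g (j + 1) UB →
          ε' * ((F.L : ℝ)⁻¹) ^ (2 * j) ≤ t →
          |‖((hol UA z (plaqWord μ ν) : (Matrix (Fin N) (Fin N) ℂ)ˣ) : Matrix (Fin N) (Fin N) ℂ) - 1‖
              - ‖((hol (rescale F.L (bavg F.L UB)) z (plaqWord μ ν) : (Matrix (Fin N) (Fin N) ℂ)ˣ) : Matrix (Fin N) (Fin N) ℂ) - 1‖| / t ≤ x) →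
        ρA j ≤ x + τA j) ∧
      (∀ j, 1 ≤ j → ∀ x : ℝ,
        (∀ (V UA UB : B7Prop1Explicit.Site 4 → Fin 4 → (Matrix (Fin N) (Fin N) ℂ)ˣ) (z : B7Prop1Explicit.Site 4) (π : Plane 4)
          (r₀ : Fin 4 → Fin F.L) (i₀ j₀ : ℕ) (t : ℝ),
          V ∈ (o F).dom → IsMinimiser 4 (sfClass 4 F.L (o F).Nper (o F).ε) F.L (o F).Nper j V UA →
          IsMinimiser 4 (sfClass 4 F.L (o F).Nper (o F).ε) F.L (o F).Nper (j + 1) V UB → Regular 4 F.L (o F).Nper (o F).b (o F).g (j + 1) UB →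
          RegularSup 4 F.L (o F).Nper (o F).b cg (j + 1) UB → i₀ < F.L → j₀ < F.L → ε' * ((F.L : ℝ)⁻¹) ^ (2 * j) ≤ t →
          |‖((hol UA z (plaqWord π.1.1 π.1.2) : (Matrix (Fin N) (Fin N) ℂ)ˣ) : Matrix (Fin N) (Fin N) ℂ) - 1‖
              - (F.L : ℝ) ^ 2 * ‖((hol UB ((F.L : ℤ) • z + boxVec F.L r₀ + (i₀ : ℤ) • e π.1.1 + (j₀ : ℤ) • e π.1.2)
                  (plaqWord π.1.1 π.1.2) : (Matrix (Fin N) (Fin N) ℂ)ˣ) : Matrix (Fin N) (Fin N) ℂ) - 1‖| / t ≤ x) →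
        ρB j ≤ x + τB j))

include hconst hS hreg hnum hread

/-- **THE K5 FACE OF N21 FROM THE CONSTANT LAYER AT THE REGIME-RESTRICTED HOME — AN ∃-WEIGHT CERTIFICATE AT EVERY GUARDED ADMISSIBLE STAGE-13 TUPLE** (θ-form; the shape
dag-n27-c XXXIX's `spine_of_homes₁₃SepOn_faces` reads its `h21` in, up to the weight slot): from `S_N16 (RRec₁₃SepOn 𝔯 Rg)` for a constant-layer rate reading, THE END's proviso at the
layer, the two numerals and NODE O's term-object readings at every guarded tuple, SOME `Wsh` with `ShellWeightBound (cr F θ hP g₀ os) … Wsh` whenever `Rg F θ` and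
`θ.Admissible F N`.  CONDITIONAL; NE7c NOT proved; N21 NOT discharged. [folklore] -/
theorem exists_shellWeight_keyedOn₁₃Sep_of_constLayer (F : T4Family) (θ : Stage13Params F N) (hP : θ.Provisos₁₃Sep F N) (hRg : Rg F θ) (hθ : θ.Admissible F N)
    (g₀ : ℕ → ℝ) (os : List (ULoop F)) :
    ∃ Wsh : ℕ → ℝ, ShellWeightBound (cr F θ hP g₀ os).l₀ (cr F θ hP g₀ os).T (cr F θ hP g₀ os).A (cr F θ hP g₀ os).B (cr F θ hP g₀ os).shA
      (cr F θ hP g₀ os).shB Wsh := by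
  obtain ⟨ε', cg, σA, σB, SA, SB, pieceA, pieceB, lvlA, lvlB, DA, ρA, DB, ρB, τA, τB, N₁, νbar, Dbar, c₂, ϑ₂, hε', hcg, hLA, hLB, hwA, hwB, hDA, hDB,
    hc₂, h₂, h₂', hτA, hτB, hdictA, hdictB⟩ := hread F θ hP hRg hθ g₀ os
  obtain ⟨ϑ, C, -, -, -, hSW⟩ := shellWeightBound_geometric_of_rRec₁₃SepOn_constLayer_inEndRegime 𝔯 o hconst (hreg F) (hnum F).1 (hnum F).2 hε' hcg hLA hLB
    hwA hwB hDA hDB hdictA hdictB Rg hS hP hRg hθ hc₂ h₂ h₂' hτA hτB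
  exact ⟨_, hSW⟩

end KeyedFaceOn

end Summit.QuantumFields.YangMills.Theorems.N21AtRRec13SepConstLayer

end
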